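import Summits.Ventures.LatticeQCDFlow.Scoring.U1TorusTopologicalChargeContinuumLimit
import Summits.Ventures.LatticeQCDFlow.Scoring.U1TorusTopologicalChargeMoments
import HarnessLib

/-!
# The continuum limit of the topological charge law holds in total variation (Scheffé)

HONEST FRAMING: exact (Metropolis-corrected) sampling algorithms for lattice gauge theory;
figures of merit are autocorrelation/cost numbers at stated couplings and volumes; no
continuum-physics claim.

Venture `LatticeQCDFlow` (cell pub-lqcd), sub-topic `Scoring`; FANOUT row 5 (`s0-sun-a`), GEN-15.
NEW WORK of the cell (placement rule).  `Scoring/U1TorusTopologicalChargeContinuumLimit.lean` proved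
`P_{L_j,β_j}(Q = k) → p_v(k) = e^{−2π²k²/v}/Σ_m e^{−2π²m²/v}` for every sector `k` when
`β_j → ∞`, `L_j²/β_j → v > 0`.  Since both sides are probability mass functions on `ℤ`
(`tsum_wilsonMeasure_topCharge_toReal` — `Σ_k P(Q = k) = 1`, from
`Scoring/U1TorusTopologicalChargeMoments.lean` — and `Σ_k p_v(k) = 1`), Scheffé's argument
(`|a − b| = (a − b) + 2(b − a)⁺`, dominated convergence of `(p_v − P_j)⁺ ≤ p_v`) upgrades this to

* **`tendsto_tsum_abs_wilsonMeasure_topCharge_sub`** — **convergence in total variation**: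
  `Σ_{k∈ℤ} |P_{L_j,β_j}(Q = k) − p_v(k)| → 0`; in particular the probability of any set of sectors
  converges, uniformly in the set.

Elementary given the parents; nothing is cited.  No sampler values.
-/

noncomputable section

open Real Filter Topology Set MeasureTheory
open scoped ENNReal
open Literature.Analysis.FunctionSpaces
open Literature.MathematicalPhysics.QuantumFieldTheory
open Literature.MathematicalPhysics.QuantumLattice (u1Rep continuous_u1Rep)
open Summit.Ventures.LatticeQCDFlow.Theory2.Lattice (topCharge)

namespace Summit.Ventures.LatticeQCDFlow.Scoring

variable {L : ℕ} [NeZero L]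

/-- The sector probabilities vanish off the finite window `|k| ≤ L²`. -/
theorem wilsonMeasure_topCharge_toReal_eq_zero_of (β : ℝ) {k : ℤ} (hk : (L : ℤ) ^ 2 < |k|) :
    (wilsonMeasure (d := 2) (L := L) u1Rep β {U | topCharge U = k}).toReal = 0 := by
  have h : (L : ℝ) ^ 2 / 2 < |(k : ℝ)| := by
    have h1 : ((L : ℤ) ^ 2 : ℝ) < |(k : ℝ)| := by rw [← Int.cast_abs]; exact_mod_cast hk
    push_cast at h1
    nlinarith [abs_nonneg (k : ℝ), sq_nonneg (L : ℝ)]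
  rw [wilsonMeasure_topCharge_eq_zero β h, ENNReal.toReal_zero]

/-- **`Σ_{k∈ℤ} P(Q = k) = 1`** (as a `tsum`; the law is a probability mass function on `ℤ`). -/
theorem hasSum_wilsonMeasure_topCharge_toReal (β : ℝ) :
    HasSum (fun k : ℤ => (wilsonMeasure (d := 2) (L := L) u1Rep β {U | topCharge U = k}).toReal) 1 := by
  have h1 := integral_comp_topCharge (L := L) β (fun _ => (1 : ℝ))
  haveI := isProbabilityMeasure_wilsonMeasure (d := 2) (L := L) u1Rep continuous_u1Rep β
  have hint : ∫ _U, (1 : ℝ) ∂(wilsonMeasure (d := 2) (L := L) u1Rep β) = 1 := by simp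
  rw [hint] at h1
  simp only [one_mul] at h1
  have hsupp : ∀ k ∉ Finset.Icc (-((L : ℤ) ^ 2)) ((L : ℤ) ^ 2),
      (wilsonMeasure (d := 2) (L := L) u1Rep β {U | topCharge U = k}).toReal = 0 := by
    intro k hk
    refine wilsonMeasure_topCharge_toReal_eq_zero_of β ?_
    simp only [Finset.mem_Icc, not_and_or, not_le] at hk
    rcases hk with hk | hk
    · rw [abs_of_neg (by nlinarith [sq_nonneg (L : ℤ)])]; linarith
    · exact lt_of_lt_of_le hk (le_abs_self k)
  have h : HasSum (fun k : ℤ => (wilsonMeasure (d := 2) (L := L) u1Rep β {U | topCharge U = k}).toReal)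
      (∑ k ∈ Finset.Icc (-((L : ℤ) ^ 2)) ((L : ℤ) ^ 2),
        (wilsonMeasure (d := 2) (L := L) u1Rep β {U | topCharge U = k}).toReal) :=
    hasSum_sum_of_ne_finset_zero hsupp
  have e : ∑ k ∈ Finset.Icc (-((L : ℤ) ^ 2)) ((L : ℤ) ^ 2),
      (wilsonMeasure (d := 2) (L := L) u1Rep β {U | topCharge U = k}).toReal = 1 := by
    rw [h1]
  rwa [e] at h

/-- Scheffé's pointwise identity: `|a − b| = (a − b) + 2·max (b − a) 0`. -/
theorem abs_sub_eq_sub_add_two_mul_max (a b : ℝ) : |a - b| = (a - b) + 2 * max (b - a) 0 := by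
  rcases le_or_gt b a with h | h
  · rw [abs_of_nonneg (by linarith), max_eq_right (by linarith)]; ring
  · rw [abs_of_neg (by linarith), max_eq_left (by linarith)]; ring

variable {Ls : ℕ → ℕ} [hNZ : ∀ j, NeZero (Ls j)]

/-- **THE CONTINUUM LIMIT IN TOTAL VARIATION (Scheffé).**  If `β_j → ∞`, `L_j ≥ 2` and
`L_j²/β_j → v > 0`, then `Σ_{k∈ℤ} |P_{L_j,β_j}(Q = k) − e^{−2π²k²/v}/Σ_m e^{−2π²m²/v}| → 0`. -/
theorem tendsto_tsum_abs_wilsonMeasure_topCharge_sub {β : ℕ → ℝ} {v : ℝ} (hv0 : 0 < v)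
    (hL : ∀ j, 2 ≤ Ls j) (hβ : Tendsto β atTop atTop)
    (hv : Tendsto (fun j => ((Ls j ^ 2 : ℕ) : ℝ) / β j) atTop (𝓝 v)) :
    Tendsto (fun j => ∑' k : ℤ, |(wilsonMeasure (d := 2) (L := Ls j) u1Rep (β j) {U | topCharge U = k}).toReal -
        Real.exp (-(2 * π ^ 2 * (k : ℝ) ^ 2 / v)) / ∑' m : ℤ, Real.exp (-(2 * π ^ 2 * (m : ℝ) ^ 2 / v))|)
      atTop (𝓝 0) := by
  set θ := ∑' m : ℤ, Real.exp (-(2 * π ^ 2 * (m : ℝ) ^ 2 / v)) with hθ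
  set p : ℤ → ℝ := fun k => Real.exp (-(2 * π ^ 2 * (k : ℝ) ^ 2 / v)) / θ with hp
  set P : ℕ → ℤ → ℝ := fun j k =>
    (wilsonMeasure (d := 2) (L := Ls j) u1Rep (β j) {U | topCharge U = k}).toReal with hP
  -- the limit pmf
  have hsumθ : Summable fun m : ℤ => Real.exp (-(2 * π ^ 2 * (m : ℝ) ^ 2 / v)) := by
    have hc : 0 < 2 * π ^ 2 / v := by positivity
    refine Summable.of_nonneg_of_le (fun m => (Real.exp_pos _).le) (fun m => ?_)
      (summable_exp_neg_mul_natAbs hc)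
    refine Real.exp_le_exp.2 ?_
    rw [Nat.cast_natAbs, Int.cast_abs]
    have : |(m : ℝ)| ≤ (m : ℝ) ^ 2 := by
      rw [← sq_abs]
      rcases eq_or_ne m 0 with rfl | hm
      · simp
      · have h1 : (1 : ℝ) ≤ |(m : ℝ)| := by
          rw [← Int.cast_abs]; exact_mod_cast Int.one_le_abs hm
        nlinarith
    have := mul_le_mul_of_nonneg_left this hc.le
    calc -(2 * π ^ 2 * (m : ℝ) ^ 2 / v) = -(2 * π ^ 2 / v * (m : ℝ) ^ 2) := by ring
      _ ≤ -(2 * π ^ 2 / v * |(m : ℝ)|) := by linarith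
      _ = -(2 * π ^ 2 / v * |(m : ℝ)|) := rfl
  have hθpos : 0 < θ := hsumθ.tsum_pos (fun m => (Real.exp_pos _).le) 0 (Real.exp_pos _)
  have hp0 : ∀ k, 0 ≤ p k := fun k => div_nonneg (Real.exp_pos _).le hθpos.le
  have hpsum : Summable p := hsumθ.div_const θ
  have hpone : HasSum p 1 := by
    have h := hsumθ.hasSum.div_const θ
    rwa [div_self hθpos.ne'] at h
  -- the lattice pmfs
  have hP0 : ∀ j k, 0 ≤ P j k := fun j k => ENNReal.toReal_nonneg
  have hPone : ∀ j, HasSum (P j) 1 := fun j => hasSum_wilsonMeasure_topCharge_toReal (β j)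
  have hlim : ∀ k, Tendsto (fun j => P j k) atTop (𝓝 (p k)) := fun k =>
    tendsto_wilsonMeasure_topCharge hv0 hL hβ hv k
  -- Scheffé: `Σ |P − p| = Σ (P − p) + 2 Σ (p − P)⁺ = 2 Σ (p − P)⁺ → 0`
  have hpos : Tendsto (fun j => ∑' k : ℤ, max (p k - P j k) 0) atTop (𝓝 0) := by
    have h := tendsto_tsum_of_dominated_convergence (𝓕 := atTop) (bound := p)
      (f := fun j k => max (p k - P j k) 0) (g := fun _ => (0 : ℝ)) hpsum ?_ ?_
    · simpa using h
    · intro k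
      have := ((tendsto_const_nhds (x := p k)).sub (hlim k)).max (tendsto_const_nhds (x := (0 : ℝ)))
      rw [sub_self, max_self] at this
      exact this
    · refine Eventually.of_forall fun j k => ?_
      rw [Real.norm_of_nonneg (le_max_right _ _)]
      exact max_le (by linarith [hP0 j k]) (hp0 k)
  have hsplit : ∀ j, ∑' k : ℤ, |P j k - p k| = 2 * ∑' k : ℤ, max (p k - P j k) 0 := by
    intro j
    have hs1 : HasSum (fun k => P j k - p k) 0 := by
      have := (hPone j).sub hpone
      rwa [sub_self] at this
    have hs2 : Summable fun k => max (p k - P j k) 0 :=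
      Summable.of_nonneg_of_le (fun k => le_max_right _ _)
        (fun k => max_le (by linarith [hP0 j k]) (hp0 k)) hpsum
    have e : (fun k : ℤ => |P j k - p k|) = fun k => (P j k - p k) + 2 * max (p k - P j k) 0 := by
      funext k; exact abs_sub_eq_sub_add_two_mul_max _ _
    rw [e, hs1.summable.tsum_add (hs2.mul_left 2), tsum_mul_left, hs1.tsum_eq, zero_add]
  have h2 := hpos.const_mul 2
  rw [mul_zero] at h2
  refine h2.congr fun j => ?_
  simp only [hP, hp, hθ] at hsplit ⊢
  exact (hsplit j).symm

end Summit.Ventures.LatticeQCDFlow.Scoring
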